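import Summits.ResolutionOfSingularities.ResolutionOfSingularities.Theorems.FrobeniusLadderFInjectiveMacaulayficationFCForallExistsDimLe2
import Summits.ResolutionOfSingularities.ResolutionOfSingularities.Theorems.FrobeniusLadderFInjectiveMacaulayficationFCUnguardedDimEq3
import Summits.ResolutionOfSingularities.ResolutionOfSingularities.Theorems.FrobeniusLadderFInjectiveMacaulayficationFCForallExistsRungs
import Summits.ResolutionOfSingularities.ResolutionOfSingularities.Theorems.FrobeniusLadderFInjectiveMacaulayficationPointFixDimOneVariety
import Summits.ResolutionOfSingularities.ResolutionOfSingularities.Theorems.FrobeniusLadderFInjectiveMacaulayficationFiniteModificationOfBlowupHolds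
import Summits.ResolutionOfSingularities.ResolutionOfSingularities.Theorems.FrobeniusLadderFInjectiveMacaulayficationRegularPointClause
import Literature.AlgebraicGeometry.Resolution.NonPrincipalLocus
import Literature.AlgebraicGeometry.Resolution.QuasiExcellentSchemes
import HarnessLib.Audit
import HarnessLib

/-!
# FC″ SPLIT BY DIMENSION: `FCUnguardedDimLe2` from FC′(dim ≤ 2) and «5e in dimension one», the residual `FCUnguardedDimGe4`,
# and door v30's `stub_fcUnguarded` reduced to dimension ≥ 4 (crux `FInjectiveMacaulayfication`, door v30)

Support file for crux stmt-ResolutionOfSingularities-15315 (`FrobeniusLadder.FInjectiveMacaulayfication`), chain w45a. [OURS · L1 W4.5a] —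
NOT a statement of any manuscript [claim: Hironaka2017]; AI-written, weaker than expert review; no statement of the manuscript is used;
named facts enter only as hypotheses (BY NAME).

Door v30's non-closed stub FC″ = `GenericFibreReduction.FCUnguarded` (p543297) is FC′ = `GenericFibreReduction.FCForallExists` with its
guard «given an `𝔪_η`-primary point-fix datum `c` at `η` …» removed.  On a surface the guard is FREE: a non-closed F-bad point `η` of an
integral `X₁` with `dim X₁ ≤ 2` has `dim 𝒪_{X₁,η} = 1` (it is not the generic point, whose local ring — the function field — is regular,
and `coheight η + 1 ≤ coheight x ≤ 2` for a proper specialisation `x` of `η`), and «5e in dimension one»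
(`PointFixDimOneVariety.h4Loc_of_dim_one_variety`, res-D-pv-019 AS stub-7: Dedekind normalisation, E. Noether finiteness) supplies a
point-fix datum at every one-dimensional local ring of a variety.  Hence **FC″(dim ≤ 2) ⟸ FC′(dim ≤ 2)** (`FCForallExistsDimLe2`, r2 file
F3 of res-L1-w45a-stub-2, p542396), and with F3's kernel and the S-V theorem (`finiteModificationOfBlowupIsBlowup_holds`, p545490):
**FC″(dim ≤ 2) ⟸ Datta–Murayama ∧ `CMLocusOpen` ∧ `S2Modification`.**  Together with `FCUnguardedDimEq3.fcUnguardedDimEq3_of_cp`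
(p546071) the FC″ ladder reads: dim ≤ 2 (this file) · dim 3 (CP 2019 + Stacks 081R) · dim ≥ 4 open.

* `FCUnguardedDimLe2` — the statement (FC″ verbatim + `topologicalKrullDim X₁ ≤ 2` after `IsIntegral X₁`, F3 convention);
* `fcUnguardedDimLe2_of_fcUnguarded` — FC″ ⇒ its dim-≤-2 rung (identity check);
* `coheight_le_one_of_not_isClosed`, `eq_genericPoint_of_coheight_eq_zero`, `ringKrullDim_stalk_eq_one_of_not_isClosed_of_not_fClause` —
  the dimension count at a non-closed F-bad point of a surface;
* `fcUnguardedDimLe2_of_fcForallExistsDimLe2` — **FC″(dim ≤ 2) ⟸ FC′(dim ≤ 2)** (the guard datum from 5e in dimension one);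
* `fcUnguardedDimLe2_of` / `fcUnguardedDimLe2_of_named` — FC″(dim ≤ 2) from `NonFullLocusClosed ∧ S2Modification`, resp. from
  Datta–Murayama ∧ `CMLocusOpen` ∧ `S2Modification`;
* `FCUnguardedDimGe4` (the RESIDUAL: FC″ verbatim + `4 ≤ topologicalKrullDim X₁`), `fcUnguardedDimGe4_of_fcUnguarded`,
  `fcUnguarded_of_rungs : FC″(≤ 2) → FC″(= 3) → FC″(≥ 4) → FC″` (exhaustive split, `FCForallExistsRungs.dim_trichotomy`), `rungs_of_fcUnguarded`;
* `fcUnguarded_of_dimGe4_named` — **door v30's `stub_fcUnguarded` ⟸ Datta–Murayama ∧ `CMLocusOpen` ∧ `S2Modification` ∧ the three threefold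
  facts ∧ FC″(dim ≥ 4)**: all remaining difficulty of the non-closed stub sits in `FCUnguardedDimGe4` (and in the two OURS statements
  `CMLocusOpen` — EGA IV 6.11.2 for excellent schemes, to be typed — and `S2Modification`, in proof by stub-2/stub-7).
-/

-- single-problem summit: the doubled namespace component is forced
set_option linter.dupNamespace false

noncomputable section

open AlgebraicGeometry CategoryTheory Literature.AlgebraicGeometry.Resolution TopologicalSpace IsLocalRing

namespace Summit.ResolutionOfSingularities.ResolutionOfSingularities.Theorems.FInjectiveMacaulayfication.FCUnguardedRungs

open Summit.ResolutionOfSingularities.ResolutionOfSingularities.Theorems.FInjectiveMacaulayfication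

/-- [OURS · candidate statement, PROVED below modulo FC′(dim ≤ 2)] **FC″ for surfaces (and curves)** — the text of
`GenericFibreReduction.FCUnguarded` VERBATIM with the single extra hypothesis `topologicalKrullDim X₁ ≤ 2` inserted after `IsIntegral X₁`.
[candidate statement, OURS] -/
@[conjecture] def FCUnguardedDimLe2 : Prop :=
  ∀ (p : ℕ), p.Prime → ∀ (k : Type) [Field k] [CharP k p]
    (X₁ : Scheme.{0}) (f₁ : X₁ ⟶ Spec (.of k)),
      IsSeparated f₁ → LocallyOfFiniteType f₁ → QuasiCompact f₁ → IsIntegral X₁ → topologicalKrullDim X₁ ≤ 2 →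
      (∀ x : X₁, (∀ d : ℕ, ringKrullDim (X₁.presheaf.stalk x) = d → ∀ s : Fin d → X₁.presheaf.stalk x,
        (Ideal.span (Set.range s)).radical.IsMaximal → RingTheory.Sequence.IsWeaklyRegular (X₁.presheaf.stalk x) (List.ofFn s))) →
      ∀ η : X₁, (¬ IsClosed ({η} : Set X₁) ∧ ¬ (∀ d : ℕ, ringKrullDim (X₁.presheaf.stalk η) = d → ∀ s : Fin d → X₁.presheaf.stalk η,
          (Ideal.span (Set.range s)).radical.IsMaximal → ∀ t : X₁.presheaf.stalk η, (∃ e : ℕ, t ^ p ^ e ∈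
            Ideal.span ((fun z : X₁.presheaf.stalk η => z ^ p ^ e) '' (Ideal.span (Set.range s) : Set (X₁.presheaf.stalk η)))) →
              t ∈ Ideal.span (Set.range s)) ∧
        ∀ y : X₁, y ⤳ η → y ≠ η → (∀ d : ℕ, ringKrullDim (X₁.presheaf.stalk y) = d → ∀ s : Fin d → X₁.presheaf.stalk y,
          (Ideal.span (Set.range s)).radical.IsMaximal → ∀ t : X₁.presheaf.stalk y, (∃ e : ℕ, t ^ p ^ e ∈
            Ideal.span ((fun z : X₁.presheaf.stalk y => z ^ p ^ e) '' (Ideal.span (Set.range s) : Set (X₁.presheaf.stalk y)))) →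
              t ∈ Ideal.span (Set.range s))) →
      ∃ (J : X₁.IdealSheafData) (n' : ℕ) (c' : Fin n' → X₁.presheaf.stalk η), J ≠ ⊥ ∧ η ∈ (J.support : Set X₁) ∧
      -- the RE-CHOSEN LocFix datum c' at η (currency (A′)): nonzero, inside 𝔪_η, charts FULL over 𝔪_η
      Ideal.span (Set.range c') ≠ ⊥ ∧ Ideal.span (Set.range c') ≤ maximalIdeal (X₁.presheaf.stalk η) ∧
        (∀ (j : Fin n') (𝔔 : PrimeSpectrum (blowupAlgebra (Ideal.span (Set.range c')) (c' j))),
          𝔔.asIdeal.comap (algebraMap (X₁.presheaf.stalk η) (blowupAlgebra (Ideal.span (Set.range c')) (c' j))) =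
            maximalIdeal (X₁.presheaf.stalk η) →
          IsDomain (Localization.AtPrime 𝔔.asIdeal) ∧ ∀ d : ℕ, ringKrullDim (Localization.AtPrime 𝔔.asIdeal) = d →
            ∀ s : Fin d → Localization.AtPrime 𝔔.asIdeal, (Ideal.span (Set.range s)).radical.IsMaximal →
              RingTheory.Sequence.IsWeaklyRegular (Localization.AtPrime 𝔔.asIdeal) (List.ofFn s) ∧
              ∀ y : Localization.AtPrime 𝔔.asIdeal, (∃ e : ℕ, y ^ p ^ e ∈ Ideal.span ((fun z : Localization.AtPrime 𝔔.asIdeal => z ^ p ^ e) ''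
                (Ideal.span (Set.range s) : Set (Localization.AtPrime 𝔔.asIdeal)))) → y ∈ Ideal.span (Set.range s)) ∧
      stalkIdeal J η = Ideal.span (Set.range c') ∧
      (∀ (X₂ : Scheme.{0}) (π : X₂ ⟶ X₁), IsBlowup π J →
        (∀ x : X₂, π.base x ∈ (J.support : Set X₁) → π.base x ≠ η → ¬ IsClosed ({x} : Set X₂) →
          IsDomain (X₂.presheaf.stalk x) ∧ ∀ d : ℕ, ringKrullDim (X₂.presheaf.stalk x) = d → ∀ s : Fin d → X₂.presheaf.stalk x,
            (Ideal.span (Set.range s)).radical.IsMaximal → RingTheory.Sequence.IsWeaklyRegular (X₂.presheaf.stalk x) (List.ofFn s) ∧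
            ∀ t : X₂.presheaf.stalk x, (∃ e : ℕ, t ^ p ^ e ∈ Ideal.span ((fun z : X₂.presheaf.stalk x => z ^ p ^ e) ''
              (Ideal.span (Set.range s) : Set (X₂.presheaf.stalk x)))) → t ∈ Ideal.span (Set.range s)) ∧
        (∀ x : X₂, π.base x ∈ (J.support : Set X₁) → IsClosed ({x} : Set X₂) →
          ∀ d : ℕ, ringKrullDim (X₂.presheaf.stalk x) = d → ∀ s : Fin d → X₂.presheaf.stalk x,
            (Ideal.span (Set.range s)).radical.IsMaximal → RingTheory.Sequence.IsWeaklyRegular (X₂.presheaf.stalk x) (List.ofFn s)))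

/-- **FC″ ⇒ FC″ in dimension ≤ 2** (discard the dimension hypothesis; identity check of the text against
`GenericFibreReduction.FCUnguarded`). [folklore] -/
theorem fcUnguardedDimLe2_of_fcUnguarded (h : GenericFibreReduction.FCUnguarded) : FCUnguardedDimLe2 :=
  fun p hp k _ _ X₁ f₁ hs hft hqc hi _ => h p hp k X₁ f₁ hs hft hqc hi

/-! ## The dimension count at a non-closed point of a surface -/

/-- On a scheme of dimension `≤ 2`, a NON-closed point has `coheight ≤ 1` (i.e. `dim 𝒪_{X,η} ≤ 1`, Stacks 02IZ): a proper
specialisation `x` of `η` has `coheight η + 1 ≤ coheight x ≤ height x + coheight x ≤ dim X ≤ 2`. [folklore]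
[cite: StacksProject, Tag 02IZ] -/
theorem coheight_le_one_of_not_isClosed {X : Scheme.{0}} (hdim : topologicalKrullDim X ≤ 2) {η : X}
    (hη : ¬ IsClosed ({η} : Set X)) : Order.coheight η ≤ 1 := by
  -- a point of the closure of `η` other than `η`
  obtain ⟨x, hx, hxη⟩ : ∃ x ∈ closure ({η} : Set X), x ≠ η := by
    by_contra h
    push Not at h
    apply hη
    have hcl : closure ({η} : Set X) = {η} :=
      Set.Subset.antisymm (fun x hx => Set.mem_singleton_iff.mpr (h x hx)) subset_closure
    rw [← hcl]
    exact isClosed_closure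
  have hsp : η ⤳ x := specializes_iff_mem_closure.mpr hx
  have hlt : x < η := lt_of_le_not_ge (Scheme.le_iff_specializes.mpr hsp) fun h' =>
    hxη (Specializes.antisymm (Scheme.le_iff_specializes.mp h') hsp).eq
  have h1 : Order.coheight η + 1 ≤ Order.coheight x := Order.coheight_add_one_le hlt
  have h2 : ((Order.height x + Order.coheight x : ℕ∞) : WithBot ℕ∞) ≤ 2 :=
    (coe_height_add_coheight_le_topologicalKrullDim x).trans hdim
  have h3 : Order.height x + Order.coheight x ≤ 2 := WithBot.coe_le_coe.mp h2
  have h4 : Order.coheight η + 1 ≤ 2 := h1.trans (le_add_self.trans h3)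
  -- `coheight η` is finite, then count
  have hne : Order.coheight η ≠ ⊤ := by
    intro htop
    rw [htop] at h4
    exact absurd h4 (by decide)
  obtain ⟨m, hm⟩ := ENat.ne_top_iff_exists.mp hne
  rw [← hm] at h4 ⊢
  have h5 : m + 1 ≤ 2 := by exact_mod_cast h4
  exact_mod_cast (by omega : m ≤ 1)

/-- On an integral scheme, a point of `coheight 0` (no proper generization) is the generic point. [folklore] -/
theorem eq_genericPoint_of_coheight_eq_zero {X : Scheme.{0}} [IsIntegral X] {η : X} (h : Order.coheight η = 0) :
    η = genericPoint X := by
  have hmax : IsMax η := Order.coheight_eq_zero.mp h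
  have h1 : η ≤ genericPoint X := Scheme.le_iff_specializes.mpr (genericPoint_specializes η)
  have h2 : genericPoint X ≤ η := hmax h1
  exact (Specializes.antisymm (Scheme.le_iff_specializes.mp h2) (genericPoint_specializes η)).eq

/-- **`dim 𝒪_{X₁,η} = 1` at a non-closed F-bad point of an integral surface** (`X₁` locally of finite type over a field of
characteristic `p`, `dim X₁ ≤ 2`): `coheight η ≤ 1` by `coheight_le_one_of_not_isClosed`, and `coheight η ≠ 0` since otherwise `η` is
the generic point, whose local ring is the function field — regular, hence FULL (`RegularPointClause.fiClause_of_mem_regularLocus`),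
contradicting F-badness. [folklore] [cite: StacksProject, Tag 02IZ] [cite: Kunz1969, Thm. 2.1] -/
theorem ringKrullDim_stalk_eq_one_of_not_isClosed_of_not_fClause (p : ℕ) [Fact p.Prime] {k : Type} [Field k] [CharP k p]
    {X₁ : Scheme.{0}} [IsIntegral X₁] (f₁ : X₁ ⟶ Spec (.of k)) (hdim : topologicalKrullDim X₁ ≤ 2) {η : X₁}
    (hη : ¬ IsClosed ({η} : Set X₁))
    (hbad : ¬ (∀ d : ℕ, ringKrullDim (X₁.presheaf.stalk η) = d → ∀ s : Fin d → X₁.presheaf.stalk η,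
      (Ideal.span (Set.range s)).radical.IsMaximal → ∀ t : X₁.presheaf.stalk η, (∃ e : ℕ, t ^ p ^ e ∈
        Ideal.span ((fun z : X₁.presheaf.stalk η => z ^ p ^ e) '' (Ideal.span (Set.range s) : Set (X₁.presheaf.stalk η)))) →
          t ∈ Ideal.span (Set.range s))) :
    ringKrullDim (X₁.presheaf.stalk η) = 1 := by
  have hle : Order.coheight η ≤ 1 := coheight_le_one_of_not_isClosed hdim hη
  have hne : Order.coheight η ≠ 0 := by
    intro h0
    have hgen : η = genericPoint X₁ := eq_genericPoint_of_coheight_eq_zero h0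
    have hreg : η ∈ Scheme.regularLocus X₁ := by
      rw [Scheme.mem_regularLocus, hgen]
      exact inferInstanceAs (IsRegularLocalRing X₁.functionField)
    exact hbad fun d hd s hrad => ((RegularPointClause.fiClause_of_mem_regularLocus p f₁ η hreg).2 d hd s hrad).2
  have h1 : Order.coheight η = 1 := le_antisymm hle (Order.one_le_iff_ne_zero.mpr hne)
  rw [ringKrullDim_stalk_eq_coheight, h1]
  rfl

/-! ## FC″(dim ≤ 2) from FC′(dim ≤ 2) -/

/-- **FC″(dim ≤ 2) ⟸ FC′(dim ≤ 2): on a surface the guard of FC′ is free.** At a non-closed F-bad point `η` of an admissible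
integral `X₁` with `dim X₁ ≤ 2` the local ring has dimension one (`ringKrullDim_stalk_eq_one_of_not_isClosed_of_not_fClause`), so «5e in
dimension one» (`PointFixDimOneVariety.h4Loc_of_dim_one_variety`: an `𝔪_η`-primary nonzero `(c)` all of whose blow-up charts are FULL over
`𝔪_η`, from the finite Dedekind normalisation) provides the datum `(n, c, hc0, hrad, hgood)` that FC′ asks for; FC′(dim ≤ 2) then returns
the conclusion, which is FC″'s. [OURS assembly] -/
theorem fcUnguardedDimLe2_of_fcForallExistsDimLe2 (h2 : FCForallExistsDimLe2.FCForallExistsDimLe2) : FCUnguardedDimLe2 := by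
  intro p hp k _ _ X₁ f₁ hs hft hqc hi hdim hCM η hη
  haveI : Fact p.Prime := ⟨hp⟩
  haveI := hft
  haveI := hi
  have hdim1 : ringKrullDim (X₁.presheaf.stalk η) = 1 :=
    ringKrullDim_stalk_eq_one_of_not_isClosed_of_not_fClause p f₁ hdim hη.1 hη.2.1
  obtain ⟨n, c, hc0, hrad, hgood⟩ := PointFixDimOneVariety.h4Loc_of_dim_one_variety p hp k X₁ f₁ η hdim1
  exact h2 p hp k X₁ f₁ hs hft hqc hi hdim hCM η hη n c hc0 hrad hgood

/-- **FC″(dim ≤ 2) from `NonFullLocusClosed` and `S2Modification`** (F3's kernel `FCForallExistsDimLe2.fcForallExistsDimLe2_of` with the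
S-V hypothesis discharged by the tree theorem `FiniteModificationOfBlowup.finiteModificationOfBlowupIsBlowup_holds`). [OURS assembly] -/
theorem fcUnguardedDimLe2_of (hNF : NonFullLocusClosed.NonFullLocusClosed) (hS2 : FCForallExistsDimLe2.S2Modification) :
    FCUnguardedDimLe2 :=
  fcUnguardedDimLe2_of_fcForallExistsDimLe2
    (FCForallExistsDimLe2.fcForallExistsDimLe2_of hNF hS2 FiniteModificationOfBlowup.finiteModificationOfBlowupIsBlowup_holds)

/-- **FC″ HOLDS IN DIMENSION ≤ 2, given Datta–Murayama 2024 Thm. B (route named fact, BY NAME), openness of the Cohen–Macaulay locus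
(`NonFullLocusClosed.CMLocusOpen`) and the S₂-ification statement `FCForallExistsDimLe2.S2Modification`.** [OURS assembly]
[cite: DattaMurayama2024, Thm. B] [cite: EGAIV2, Prop. 6.11.2] -/
theorem fcUnguardedDimLe2_of_named
    (hDM : Literature.AlgebraicGeometry.Resolution.DattaMurayama2024_fInjectiveLocusOpen.{0})
    (hCMo : NonFullLocusClosed.CMLocusOpen) (hS2 : FCForallExistsDimLe2.S2Modification) : FCUnguardedDimLe2 :=
  fcUnguardedDimLe2_of_fcForallExistsDimLe2
    (FCForallExistsDimLe2.fcForallExistsDimLe2_of_named hDM hCMo hS2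
      FiniteModificationOfBlowup.finiteModificationOfBlowupIsBlowup_holds)

/-! ## The residual FC″(dim ≥ 4), the exhaustive split, and `stub_fcUnguarded` reduced to dimension ≥ 4 -/

/-- [OURS · candidate statement, the RESIDUAL] **FC″ in dimension ≥ 4** — `GenericFibreReduction.FCUnguarded` VERBATIM with the single extra
hypothesis `4 ≤ topologicalKrullDim X₁` inserted after `IsIntegral X₁`. Nothing in the tree bears on it: the LocFix datum at a wild
non-closed `η` and the CM-ness of the new closed points over `closure {η}` are both open here (census ROUTES-DIM4). [candidate statement, OURS] -/
@[conjecture] def FCUnguardedDimGe4 : Prop :=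
  ∀ (p : ℕ), p.Prime → ∀ (k : Type) [Field k] [CharP k p]
    (X₁ : Scheme.{0}) (f₁ : X₁ ⟶ Spec (.of k)),
      IsSeparated f₁ → LocallyOfFiniteType f₁ → QuasiCompact f₁ → IsIntegral X₁ → 4 ≤ topologicalKrullDim X₁ →
      (∀ x : X₁, (∀ d : ℕ, ringKrullDim (X₁.presheaf.stalk x) = d → ∀ s : Fin d → X₁.presheaf.stalk x,
        (Ideal.span (Set.range s)).radical.IsMaximal → RingTheory.Sequence.IsWeaklyRegular (X₁.presheaf.stalk x) (List.ofFn s))) →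
      ∀ η : X₁, (¬ IsClosed ({η} : Set X₁) ∧ ¬ (∀ d : ℕ, ringKrullDim (X₁.presheaf.stalk η) = d → ∀ s : Fin d → X₁.presheaf.stalk η,
          (Ideal.span (Set.range s)).radical.IsMaximal → ∀ t : X₁.presheaf.stalk η, (∃ e : ℕ, t ^ p ^ e ∈
            Ideal.span ((fun z : X₁.presheaf.stalk η => z ^ p ^ e) '' (Ideal.span (Set.range s) : Set (X₁.presheaf.stalk η)))) →
              t ∈ Ideal.span (Set.range s)) ∧
        ∀ y : X₁, y ⤳ η → y ≠ η → (∀ d : ℕ, ringKrullDim (X₁.presheaf.stalk y) = d → ∀ s : Fin d → X₁.presheaf.stalk y,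
          (Ideal.span (Set.range s)).radical.IsMaximal → ∀ t : X₁.presheaf.stalk y, (∃ e : ℕ, t ^ p ^ e ∈
            Ideal.span ((fun z : X₁.presheaf.stalk y => z ^ p ^ e) '' (Ideal.span (Set.range s) : Set (X₁.presheaf.stalk y)))) →
              t ∈ Ideal.span (Set.range s))) →
      ∃ (J : X₁.IdealSheafData) (n' : ℕ) (c' : Fin n' → X₁.presheaf.stalk η), J ≠ ⊥ ∧ η ∈ (J.support : Set X₁) ∧
      -- the RE-CHOSEN LocFix datum c' at η (currency (A′)): nonzero, inside 𝔪_η, charts FULL over 𝔪_η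
      Ideal.span (Set.range c') ≠ ⊥ ∧ Ideal.span (Set.range c') ≤ maximalIdeal (X₁.presheaf.stalk η) ∧
        (∀ (j : Fin n') (𝔔 : PrimeSpectrum (blowupAlgebra (Ideal.span (Set.range c')) (c' j))),
          𝔔.asIdeal.comap (algebraMap (X₁.presheaf.stalk η) (blowupAlgebra (Ideal.span (Set.range c')) (c' j))) =
            maximalIdeal (X₁.presheaf.stalk η) →
          IsDomain (Localization.AtPrime 𝔔.asIdeal) ∧ ∀ d : ℕ, ringKrullDim (Localization.AtPrime 𝔔.asIdeal) = d →
            ∀ s : Fin d → Localization.AtPrime 𝔔.asIdeal, (Ideal.span (Set.range s)).radical.IsMaximal →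
              RingTheory.Sequence.IsWeaklyRegular (Localization.AtPrime 𝔔.asIdeal) (List.ofFn s) ∧
              ∀ y : Localization.AtPrime 𝔔.asIdeal, (∃ e : ℕ, y ^ p ^ e ∈ Ideal.span ((fun z : Localization.AtPrime 𝔔.asIdeal => z ^ p ^ e) ''
                (Ideal.span (Set.range s) : Set (Localization.AtPrime 𝔔.asIdeal)))) → y ∈ Ideal.span (Set.range s)) ∧
      stalkIdeal J η = Ideal.span (Set.range c') ∧
      (∀ (X₂ : Scheme.{0}) (π : X₂ ⟶ X₁), IsBlowup π J →
        (∀ x : X₂, π.base x ∈ (J.support : Set X₁) → π.base x ≠ η → ¬ IsClosed ({x} : Set X₂) →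
          IsDomain (X₂.presheaf.stalk x) ∧ ∀ d : ℕ, ringKrullDim (X₂.presheaf.stalk x) = d → ∀ s : Fin d → X₂.presheaf.stalk x,
            (Ideal.span (Set.range s)).radical.IsMaximal → RingTheory.Sequence.IsWeaklyRegular (X₂.presheaf.stalk x) (List.ofFn s) ∧
            ∀ t : X₂.presheaf.stalk x, (∃ e : ℕ, t ^ p ^ e ∈ Ideal.span ((fun z : X₂.presheaf.stalk x => z ^ p ^ e) ''
              (Ideal.span (Set.range s) : Set (X₂.presheaf.stalk x)))) → t ∈ Ideal.span (Set.range s)) ∧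
        (∀ x : X₂, π.base x ∈ (J.support : Set X₁) → IsClosed ({x} : Set X₂) →
          ∀ d : ℕ, ringKrullDim (X₂.presheaf.stalk x) = d → ∀ s : Fin d → X₂.presheaf.stalk x,
            (Ideal.span (Set.range s)).radical.IsMaximal → RingTheory.Sequence.IsWeaklyRegular (X₂.presheaf.stalk x) (List.ofFn s)))

/-- FC″ ⇒ FC″(dim ≥ 4) (discard the dimension hypothesis; identity check). [folklore] -/
theorem fcUnguardedDimGe4_of_fcUnguarded (h : GenericFibreReduction.FCUnguarded) : FCUnguardedDimGe4 :=
  fun p hp k _ _ X₁ f₁ hs hft hqc hi _ => h p hp k X₁ f₁ hs hft hqc hi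

/-- **The dimension split of FC″ is exhaustive**: `FC″(dim ≤ 2) → FC″(dim = 3) → FC″(dim ≥ 4) → FC″`
(`FCForallExistsRungs.dim_trichotomy`). [plumbing] -/
theorem fcUnguarded_of_rungs (h2 : FCUnguardedDimLe2) (h3 : FCUnguardedDimEq3.FCUnguardedDimEq3) (h4 : FCUnguardedDimGe4) :
    GenericFibreReduction.FCUnguarded := by
  intro p hp k _ _ X₁ f₁ hsep hft hqc hint
  rcases FCForallExistsRungs.dim_trichotomy (topologicalKrullDim X₁) with hd | hd | hd
  · exact h2 p hp k X₁ f₁ hsep hft hqc hint hd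
  · exact h3 p hp k X₁ f₁ hsep hft hqc hint hd
  · exact h4 p hp k X₁ f₁ hsep hft hqc hint hd

/-- Sanity: each rung is a weakening of FC″ (an honest case split). [plumbing] -/
theorem rungs_of_fcUnguarded (h : GenericFibreReduction.FCUnguarded) :
    FCUnguardedDimLe2 ∧ FCUnguardedDimEq3.FCUnguardedDimEq3 ∧ FCUnguardedDimGe4 :=
  ⟨fcUnguardedDimLe2_of_fcUnguarded h, FCUnguardedDimEq3.fcUnguardedDimEq3_of_fcUnguarded h, fcUnguardedDimGe4_of_fcUnguarded h⟩

/-- **DOOR v30's NON-CLOSED STUB `stub_fcUnguarded` REDUCED TO DIMENSION ≥ 4.** Given Datta–Murayama 2024 Thm. B, openness of the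
Cohen–Macaulay locus (`NonFullLocusClosed.CMLocusOpen`), the S₂-ification statement (`FCForallExistsDimLe2.S2Modification`) and the three
threefold facts `CossartPiltant2019General` / `Stacks081R` / `CossartPiltant2019Principalization` (all BY NAME), FC″ follows from its
dimension-≥-4 residual `FCUnguardedDimGe4` alone: dim ≤ 2 by `fcUnguardedDimLe2_of_named` (this file), dim 3 by
`FCUnguardedDimEq3.fcUnguardedDimEq3_of_cp` (p546071). [OURS assembly] [cite: DattaMurayama2024, Thm. B]
[cite: CossartPiltant2019, Thm. 1.1 (i)(ii); Prop. 4.4] [cite: StacksProject, Tag 081T] -/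
theorem fcUnguarded_of_dimGe4_named
    (hDM : Literature.AlgebraicGeometry.Resolution.DattaMurayama2024_fInjectiveLocusOpen.{0})
    (hCMo : NonFullLocusClosed.CMLocusOpen) (hS2 : FCForallExistsDimLe2.S2Modification)
    (hG : CossartPiltant2019General.{0}) (h081R : Stacks081R.{0}) (hP : CossartPiltant2019Principalization.{0})
    (h4 : FCUnguardedDimGe4) : GenericFibreReduction.FCUnguarded :=
  fcUnguarded_of_rungs (fcUnguardedDimLe2_of_named hDM hCMo hS2) (FCUnguardedDimEq3.fcUnguardedDimEq3_of_cp hG h081R hP) h4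

end Summit.ResolutionOfSingularities.ResolutionOfSingularities.Theorems.FInjectiveMacaulayfication.FCUnguardedRungs

end
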